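import Literature.Computability.Cryptography.RegevSamplerQuery
import Literature.Computability.Cryptography.RegevReductionStepSplit
import HarnessLib

/-!
# Regev 2009, Lemma 3.14 in machine form: the sampler's `CVP` queries are admissible on short lattice parts

Topic `Computability/Cryptography` (family `pqc`), grouping namespace `Regev2009.SamplerArith`; sequel
of `RegevSamplerArith.lean` (`floor_sub_reprPt_eq`: the residue point `Σⱼ (sⱼ/R) b∨ⱼ` of a grid point
`x` and its lattice part `x − y(x) = ⌊x⌋_Λ` differ by the point `Σⱼ mⱼ b∨ⱼ` of `L*`), of
`RegevSamplerQuery.lean` (`inRange_sNat`) and of `RegevReductionStepSplit.lean` (`CVPOracle.Admissible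
I d c`: in range, `b_c ≤ ℓ_R`, and the query point `CVPOracle.point I c` within `d` of `L* = L(B)*`).
In Regev's sampler (J. ACM 56 (2009), art. 34; author's version arXiv:2401.03703, Lemma 3.14 and its
proof, run with the `CVP_{L*, d}` procedure as in the proof of Lemma 3.3) the oracle is asked the
residue point of `x`; this file proves that the query is ADMISSIBLE — within the promise radius `d` of
`L*` — as soon as the lattice part of `x` has norm at most `d` (Regev: "for such `x`, the oracle
returns …"; the other points are charged to the Gaussian tail, `Algebra/EuclideanLattices/
RegevQuantumPartLongTail.lean`, `RegevCVPOracleTail.lean`):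

* `point_sNat` — the query point of the residues `sNat I 2^{ℓ_R} x` is `Σⱼ (sⱼ/2^{ℓ_R}) b∨ⱼ`;
* `point_sNat_eq_floor_sub` — it is `⌊x⌋_Λ − Σⱼ mⱼ b∨ⱼ`, a translate of the lattice part by `L*`;
* **`admissible_sNat_of_norm_floor_le`**, **`admissible_sNat_of_norm_sub_fract_le`** — if
  `‖x − y(x)‖ ≤ d` (`y(x) = ZSpan.fract`, the branch) and `b_c ≤ ℓ_R`, the data
  `(sNat I 2^{ℓ_R} x, ℓ_R, b_c)` are `Admissible I d`.

Everything is proved; no definition, no named fact is introduced.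

## References

* O. Regev, *On lattices, learning with errors, random linear codes, and cryptography*, J. ACM 56
  (2009), art. 34; author's version arXiv:2401.03703: Lemma 3.14 (proof, p. 20), Lemma 3.3 (proof,
  p. 15), Lemma 3.4 [Regev2009].
* D. Micciancio, S. Goldwasser, *Complexity of Lattice Problems*, Kluwer 2002, Ch. 1 §1.1 (the dual
  lattice) [MicciancioGoldwasser2002].
-/

noncomputable section

namespace Literature.Computability.Cryptography

namespace Regev2009

namespace SamplerArith

open Literature.Algebra.EuclideanLattices Literature.Algebra.EuclideanLattices.Regev2009 Peikert2009 Matrix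
  Finset SamplerQuery
open scoped InnerProductSpace

variable (I : LatticeInstance) [hZ : IsZLattice ℝ I.lattice]

/-- **The query point of the residues**: `point I (sNat x, ℓ_R, b_c) = Σⱼ (sⱼ/2^{ℓ_R}) b∨ⱼ`.
[cite: Regev2009, Lemma 3.14 (proof: "the natural mapping between L*/R ∩ P(L*) and ℤ_Rⁿ")] -/
theorem point_sNat (ℓR bc : ℕ) (x : Fin I.n → ℤ) :
    CVPOracle.point I (sNat I (2 ^ ℓR) x, ℓR, bc) = ∑ j, ((sNat I (2 ^ ℓR) x j : ℝ) / ((2 ^ ℓR : ℕ) : ℝ)) • dualVec I j := by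
  rw [CVPOracle.point_eq]
  push_cast
  rfl

/-- **The query point is the lattice part translated by a point of `L*`**:
`point I (sNat x, ℓ_R, b_c) = ⌊x⌋_Λ − Σⱼ mⱼ b∨ⱼ`. [cite: Regev2009, Lemma 3.14 (proof: "using the CVP oracle, we can recover x")] -/
theorem point_sNat_eq_floor_sub (ℓR bc : ℕ) (x : Fin I.n → ℤ) :
    CVPOracle.point I (sNat I (2 ^ ℓR) x, ℓR, bc) =
      (ZSpan.floor (eB I (2 ^ ℓR)) (gridPt I (2 ^ ℓR) x) : EuclideanSpace ℝ (Fin I.n)) -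
        ∑ j, (mVec I (2 ^ ℓR) x j : ℝ) • dualVec I j := by
  rw [point_sNat, ← floor_sub_reprPt_eq I (2 ^ ℓR) x, sub_sub_cancel]

/-- **The query is admissible when the lattice part is within the promise radius**: `‖⌊x⌋_Λ‖ ≤ d` and
`b_c ≤ ℓ_R` give `Admissible I d (sNat x, ℓ_R, b_c)` (the dual point `−Σⱼ mⱼ b∨ⱼ` is within `d` of the
query point). [cite: Regev2009, Lemma 3.14 (proof), Lemma 3.3 (proof: the `CVP_{L*, αq/(√2 r)}` promise)] -/
theorem admissible_sNat_of_norm_floor_le {ℓR bc : ℕ} (hbc : bc ≤ ℓR) (x : Fin I.n → ℤ) {d : ℝ}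
    (hd : ‖(ZSpan.floor (eB I (2 ^ ℓR)) (gridPt I (2 ^ ℓR) x) : EuclideanSpace ℝ (Fin I.n))‖ ≤ d) :
    CVPOracle.Admissible I d (sNat I (2 ^ ℓR) x, ℓR, bc) := by
  refine ⟨inRange_sNat I (Nat.two_pow_pos ℓR) le_rfl bc x, hbc, -(∑ j, (mVec I (2 ^ ℓR) x j : ℝ) • dualVec I j),
    Submodule.neg_mem _ (sum_mVec_smul_mem I (2 ^ ℓR) x), ?_⟩
  rwa [point_sNat_eq_floor_sub, sub_neg_eq_add, sub_add_cancel]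

/-- **The same with the branch**: `‖x − y(x)‖ ≤ d`, `y(x) = ZSpan.fract_Λ x` the reduction of the grid
point modulo `P(Λ)`, gives `Admissible I d (sNat x, ℓ_R, b_c)`. [cite: Regev2009, Lemma 3.14 (proof), Lemma 3.3 (proof)] -/
theorem admissible_sNat_of_norm_sub_fract_le {ℓR bc : ℕ} (hbc : bc ≤ ℓR) (x : Fin I.n → ℤ) {d : ℝ}
    (hd : ‖gridPt I (2 ^ ℓR) x - ZSpan.fract (eB I (2 ^ ℓR)) (gridPt I (2 ^ ℓR) x)‖ ≤ d) :
    CVPOracle.Admissible I d (sNat I (2 ^ ℓR) x, ℓR, bc) := by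
  rw [gridPt_sub_fract] at hd
  exact admissible_sNat_of_norm_floor_le I hbc x hd

end SamplerArith

end Regev2009

end Literature.Computability.Cryptography

end
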